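import Mathlib
import Literature.NumberTheory.LFunctions.Zhang2022.Section17U021ChiR1Prelims
import Literature.NumberTheory.LFunctions.Zhang2022.Section17NuMinusRadical
import Literature.NumberTheory.LFunctions.Zhang2022.ToolkitDivisorMajorants
import Literature.NumberTheory.LFunctions.Zhang2022.ToolkitSmallPrimeFactorSums
import HarnessLib

/-!
# Zhang (2022) §17.u021 (χ-reading), remainder `R₁` — piece A2: the `m₂`-sum over SMALL arguments
# (`l₂m₂ ≤ D⁴`) in Case A (`m₂` has a prime not dividing `m₁`), with the `l₂`-dependence KEPT

Topic `Literature/NumberTheory/LFunctions/Zhang2022` (Landau–Siegel audit tree; verdict-neutral).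
Y. Zhang, *Discrete mean estimates and the Landau–Siegel zero*, arXiv:2211.02515v1 (2022)
[Zhang2022LandauSiegel] — **an unrefereed manuscript under adjudication; nothing here asserts or denies
its Theorems 1–2.** Lane ZHANG-L, WP16, sub-leaf `R1Rel` (the `m₂ ≥ 2` remainder of §17.u021 in relative
currency; owner zl-libB-p6 g2, HOME/libB/zl-libB-p6/R1-NODE.md §4–5; this file = piece A2 by the helper
zl-w10-p5). §17 p. 98 (tex L4825): "we can drop the terms with `m₂ > 1` … with an acceptable error".

For `l₂m₂ ≤ D⁴` the factor `ν₁*(l₂m₂)` keeps its cancellation through zl-w16-p3's majorant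
`Phi3Eval.norm_nuOneStar_le` (`|ν₁*(m)| ≤ |(μχ∗1)(m)| + 3δτ₄(m)`, `m ≤ D⁴`), and `(μχ∗1)` is split off the
`m₂`-variable by zl-w16-p3's SUB-MULTIPLICATIVITY `|(μχ∗1)(l₂m₂)| ≤ |(μχ∗1)(l₂)|·τ₂(m₂)`
(`Phi3Eval.norm_nuMinus_mul_le_tau`, `Section17NuMinusRadical`); in Case A the factor `κ̄₂(m₁m₂)` carries the gain
`|b₁|log p ≤ |b₁|log D⁴` over `κ̄₂(m₁)` (`Typed.Section17.norm_kappa2bar_mul_le_of_prime`). Hence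

* `caseA_small_sum_le` — **A2**: for `l₂ ≥ 1`, `m₁ ≥ 1`, `l₂N ≤ D⁴`, `|b₁|log D⁴ ≤ 1` and the §17 weight
  facts `‖nN_β(n) − 1‖ ≤ δ ≤ 1` (`n ≤ D⁴`):
  `Σ_{2≤m₂≤N, (m₂,l₁)=1, ∃p∣m₂: p∤m₁} |ν₁*(l₂m₂)|·|κ̄₂(m₁m₂)|/m₂ ≤
   |κ̄₂(m₁)|·(|b₁|log D⁴)·(|(μχ∗1)(l₂)|·(1+log N)² + 3δ·τ₄(l₂)·(1+log N)⁴)`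
  (`Σ_{m≤N}τ_j(m)/m ≤ (1+log N)^j`, `ToolkitDivisorMajorants.sum_tau_div_Icc_le_log_pow`).

Theorems only; no definitions, no named facts; axioms standard. The outer count (in `𝔞`-currency) and the
other pieces (Case B, large arguments) are NOT treated here.

## References

* Y. Zhang, arXiv:2211.02515v1 (2022), §17 p. 98 (u021, tex L4825); App. A p. 105 (`κ₂`).
  [cite: Zhang2022LandauSiegel, §17 u021 p.98]
-/

noncomputable section

open Complex Real ComplexConjugate Finset ArithmeticFunction

namespace Literature.NumberTheory.LFunctions.Zhang2022.Typed.Section17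

open Literature.NumberTheory.LFunctions.Zhang2022
open Literature.NumberTheory.LFunctions.Zhang2022.Skeleton
open Literature.NumberTheory.LFunctions.Zhang2022.MeanSquareMajorant
open Literature.NumberTheory.LFunctions.Zhang2022.Phi3Eval (norm_nuOneStar_le norm_nuMinus_mul_le_tau)

variable {D : ℕ} (χ : DirichletCharacter ℂ D)

/-! ## A2: the small-argument Case-A `m₂`-sum -/

/-- **A2 (R1-NODE.md §4): the `m₂`-sum over small arguments in Case A.** Let `δ ∈ [0,1]` bound the §17
weight defects `‖nN_β(n) − 1‖` for `n ≤ D⁴` (`β = β₂, β₃`), let `|b₁|log D⁴ ≤ 1`, `l₂, m₁ ≥ 1` and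
`l₂N ≤ D⁴`. Then
`Σ_{2≤m₂≤N, (m₂,l₁)=1, ∃p∣m₂: p∤m₁} ‖ν₁*(l₂m₂)‖·‖κ̄₂(m₁m₂)‖/m₂ ≤
‖κ̄₂(m₁)‖·(|b₁|log D⁴)·(‖(μχ∗1)(l₂)‖·(1+log N)² + 3δ·τ₄(l₂)·(1+log N)⁴)`.
[cite: Zhang2022LandauSiegel, §17 u021 p.98] -/
theorem caseA_small_sum_le (c' : ℝ) {δ : ℝ} (hδ0 : 0 ≤ δ) (hδ1 : δ ≤ 1)
    (hη : ∀ n : ℕ, n ≠ 0 → n ≤ D ^ 4 →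
      ‖nN D (beta2 c' D) n - 1‖ ≤ δ ∧ ‖nN D (beta3 c' D) n - 1‖ ≤ δ)
    (hb : |b1 c' D| * Real.log ((D : ℝ) ^ 4) ≤ 1)
    {l₁ l₂ m₁ N : ℕ} (hl₂ : 1 ≤ l₂) (hm₁ : 1 ≤ m₁) (hN : l₂ * N ≤ D ^ 4) :
    ∑ m₂ ∈ (Finset.Icc 2 N).filter (fun m₂ => Nat.Coprime m₂ l₁ ∧ ∃ p ∈ m₂.primeFactors, ¬ p ∣ m₁),
        ‖nuOneStar c' χ (l₂ * m₂)‖ * ‖kappa2bar c' D (m₁ * m₂)‖ / m₂ ≤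
      ‖kappa2bar c' D m₁‖ * (|b1 c' D| * Real.log ((D : ℝ) ^ 4)) *
        (‖∑ d ∈ l₂.divisors, (ArithmeticFunction.moebius d : ℂ) * χ (d : ZMod D)‖ *
            (1 + Real.log N) ^ 2 +
          3 * δ * tau 4 l₂ * (1 + Real.log N) ^ 4) := by
  set θ : ℝ := |b1 c' D| * Real.log ((D : ℝ) ^ 4) with hθ
  set Ml₂ : ℝ := ‖∑ d ∈ l₂.divisors, (ArithmeticFunction.moebius d : ℂ) * χ (d : ZMod D)‖ with hMl₂
  have hθ0 : 0 ≤ θ := by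
    rw [hθ]
    rcases Nat.eq_zero_or_pos D with hD | hD
    · simp [hD]
    · exact mul_nonneg (abs_nonneg _) (Real.log_nonneg (by exact_mod_cast Nat.one_le_pow 4 D hD))
  have hκ0 : 0 ≤ ‖kappa2bar c' D m₁‖ := norm_nonneg _
  have hl₂0 : l₂ ≠ 0 := by omega
  have hm₁0 : m₁ ≠ 0 := by omega
  -- every `m₂` in the range has all its primes `≤ D⁴`, so `|b₁|log q ≤ θ ≤ 1`
  have hND : N ≤ D ^ 4 := le_trans (Nat.le_mul_of_pos_left N (by omega)) hN
  have hlogq : ∀ {m₂ : ℕ}, m₂ ≤ N → ∀ q ∈ m₂.primeFactors, |b1 c' D| * Real.log q ≤ θ := by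
    intro m₂ hm₂ q hq
    have hqle : q ≤ m₂ := Nat.le_of_mem_primeFactors hq
    have hq1 : 1 ≤ q := (Nat.prime_of_mem_primeFactors hq).one_lt.le
    have hqD : (q : ℝ) ≤ (D : ℝ) ^ 4 := by exact_mod_cast hqle.trans (hm₂.trans hND)
    rw [hθ]
    exact mul_le_mul_of_nonneg_left (Real.log_le_log (by exact_mod_cast hq1) hqD) (abs_nonneg _)
  -- termwise bound
  have hterm : ∀ m₂ ∈ (Finset.Icc 2 N).filter
      (fun m₂ => Nat.Coprime m₂ l₁ ∧ ∃ p ∈ m₂.primeFactors, ¬ p ∣ m₁),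
      ‖nuOneStar c' χ (l₂ * m₂)‖ * ‖kappa2bar c' D (m₁ * m₂)‖ / m₂ ≤
        ‖kappa2bar c' D m₁‖ * θ * ((Ml₂ * tau 2 m₂ + 3 * δ * tau 4 l₂ * tau 4 m₂) / m₂) := by
    intro m₂ hm
    rw [Finset.mem_filter, Finset.mem_Icc] at hm
    obtain ⟨⟨hm2, hmN⟩, -, p, hp, hpm⟩ := hm
    have hm₂0 : m₂ ≠ 0 := by omega
    have hm₂pos : (0 : ℝ) < m₂ := by exact_mod_cast (by omega : 0 < m₂)
    -- the gain
    have hgain : ‖kappa2bar c' D (m₁ * m₂)‖ ≤ θ * ‖kappa2bar c' D m₁‖ := by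
      have hsmall : ∀ q ∈ m₂.primeFactors, |b1 c' D| * Real.log q ≤ 1 :=
        fun q hq => (hlogq hmN q hq).trans hb
      calc ‖kappa2bar c' D (m₁ * m₂)‖ ≤ |b1 c' D| * Real.log p * ‖kappa2bar c' D m₁‖ :=
            norm_kappa2bar_mul_le_of_prime c' D hm₁0 hm₂0 hp hpm hsmall
        _ ≤ θ * ‖kappa2bar c' D m₁‖ := mul_le_mul_of_nonneg_right (hlogq hmN p hp) hκ0
    -- the `ν₁*` majorant with the `l₂`-dependence kept
    have hlm : l₂ * m₂ ≤ D ^ 4 := le_trans (Nat.mul_le_mul_left l₂ hmN) hN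
    have hν : ‖nuOneStar c' χ (l₂ * m₂)‖ ≤ Ml₂ * tau 2 m₂ + 3 * δ * tau 4 l₂ * tau 4 m₂ := by
      refine (norm_nuOneStar_le c' χ hδ0 hδ1 hlm hη).trans ?_
      refine add_le_add ((norm_nuMinus_mul_le_tau χ hl₂0 hm₂0).trans_eq (by rw [tau_two_apply])) ?_
      calc 3 * δ * tau 4 (l₂ * m₂) ≤ 3 * δ * (tau 4 l₂ * tau 4 m₂) :=
            mul_le_mul_of_nonneg_left (tau_mul_le 4 l₂ m₂) (by positivity)
        _ = 3 * δ * tau 4 l₂ * tau 4 m₂ := by ring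
    have hν0 : 0 ≤ ‖nuOneStar c' χ (l₂ * m₂)‖ := norm_nonneg _
    have hB0 : 0 ≤ Ml₂ * tau 2 m₂ + 3 * δ * tau 4 l₂ * tau 4 m₂ :=
      add_nonneg (mul_nonneg (norm_nonneg _) (tau_nonneg _ _)) (by
        have := tau_nonneg 4 l₂; have := tau_nonneg 4 m₂; positivity)
    rw [div_eq_mul_inv, div_eq_mul_inv]
    calc ‖nuOneStar c' χ (l₂ * m₂)‖ * ‖kappa2bar c' D (m₁ * m₂)‖ * (m₂ : ℝ)⁻¹
        ≤ (Ml₂ * tau 2 m₂ + 3 * δ * tau 4 l₂ * tau 4 m₂) * (θ * ‖kappa2bar c' D m₁‖) * (m₂ : ℝ)⁻¹ :=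
          mul_le_mul_of_nonneg_right (mul_le_mul hν hgain (norm_nonneg _) hB0) (inv_nonneg.mpr hm₂pos.le)
      _ = ‖kappa2bar c' D m₁‖ * θ * ((Ml₂ * tau 2 m₂ + 3 * δ * tau 4 l₂ * tau 4 m₂) * (m₂ : ℝ)⁻¹) := by
          ring
  -- sum over the filter ⊆ `Icc 1 N`
  have hsub : (Finset.Icc 2 N).filter (fun m₂ => Nat.Coprime m₂ l₁ ∧ ∃ p ∈ m₂.primeFactors, ¬ p ∣ m₁) ⊆
      Finset.Icc 1 N := fun m₂ hm => by
    rw [Finset.mem_filter, Finset.mem_Icc] at hm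
    rw [Finset.mem_Icc]; omega
  have hnonneg : ∀ m₂ ∈ Finset.Icc 1 N,
      0 ≤ ‖kappa2bar c' D m₁‖ * θ * ((Ml₂ * tau 2 m₂ + 3 * δ * tau 4 l₂ * tau 4 m₂) / m₂) := by
    intro m₂ _
    have : 0 ≤ Ml₂ * tau 2 m₂ + 3 * δ * tau 4 l₂ * tau 4 m₂ :=
      add_nonneg (mul_nonneg (norm_nonneg _) (tau_nonneg _ _)) (by
        have := tau_nonneg 4 l₂; have := tau_nonneg 4 m₂; positivity)
    positivity
  have h2 := sum_tau_div_Icc_le_log_pow 2 N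
  have h4 := sum_tau_div_Icc_le_log_pow 4 N
  calc ∑ m₂ ∈ (Finset.Icc 2 N).filter (fun m₂ => Nat.Coprime m₂ l₁ ∧ ∃ p ∈ m₂.primeFactors, ¬ p ∣ m₁),
        ‖nuOneStar c' χ (l₂ * m₂)‖ * ‖kappa2bar c' D (m₁ * m₂)‖ / m₂
      ≤ ∑ m₂ ∈ (Finset.Icc 2 N).filter (fun m₂ => Nat.Coprime m₂ l₁ ∧ ∃ p ∈ m₂.primeFactors, ¬ p ∣ m₁),
          ‖kappa2bar c' D m₁‖ * θ * ((Ml₂ * tau 2 m₂ + 3 * δ * tau 4 l₂ * tau 4 m₂) / m₂) :=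
        Finset.sum_le_sum hterm
    _ ≤ ∑ m₂ ∈ Finset.Icc 1 N, ‖kappa2bar c' D m₁‖ * θ *
          ((Ml₂ * tau 2 m₂ + 3 * δ * tau 4 l₂ * tau 4 m₂) / m₂) :=
        Finset.sum_le_sum_of_subset_of_nonneg hsub fun m₂ hm _ => hnonneg m₂ hm
    _ = ‖kappa2bar c' D m₁‖ * θ *
          (Ml₂ * ∑ m₂ ∈ Finset.Icc 1 N, tau 2 m₂ / m₂ +
            3 * δ * tau 4 l₂ * ∑ m₂ ∈ Finset.Icc 1 N, tau 4 m₂ / m₂) := by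
        simp only [Finset.mul_sum, ← Finset.sum_add_distrib]
        exact Finset.sum_congr rfl fun m₂ _ => by ring
    _ ≤ ‖kappa2bar c' D m₁‖ * θ * (Ml₂ * (1 + Real.log N) ^ 2 + 3 * δ * tau 4 l₂ * (1 + Real.log N) ^ 4) := by
        have hτ4 : 0 ≤ 3 * δ * tau 4 l₂ := by have := tau_nonneg 4 l₂; positivity
        gcongr

end Literature.NumberTheory.LFunctions.Zhang2022.Typed.Section17
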